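import Literature.Analysis.FluidPDE.TaoSingleScaleGeometry
import Literature.Analysis.FluidPDE.TaoAveragedSingleScaleAt
import HarnessLib

/-!
# Tao 2016, §3.4: the frequency geometry of the single-scale reduction about a GENERAL base triple

T. Tao, *Finite time blowup for an averaged three-dimensional Navier–Stokes equation*,
J. Amer. Math. Soc. **29** (2016), 601–674 = arXiv:1402.0290v3, §3.3–§3.4 pp. 16–17 ("thus
`η(|ξ₁|,|ξ₂|,|ξ₃|)` is only non-vanishing when `ξ₁, ξ₂, ξ₃` have comparable magnitude"; "`ρ` is
supported on the union of the balls `(1+ε₀)ⁿ · B(ξ₁⁰, 2ε₀²)`"; cross terms are "vanishing otherwise if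
`ε₀` is small enough (thanks to the support properties of `m_{i,ω,n}`, `η` and `ρ`)"). Sequel of
`TaoSingleScaleGeometry.lean`, which makes these elementary inequalities explicit at Tao's
normalisation (3.7) (moduli `1, √2, 1`, all in `[1, 3/2]`). HONEST FRAMING (cell
harvest/h2-tao-ladder, TAO-LADDER rung M_1 — MODEL statements about Tao's averaged equation): this
file records the same inequalities for base moduli `r ∈ [1/2, 2]` (Remark 3.5: the argument at a
general base triple), with the constants adjusted — radial cut-offs of width `5ε₀³` (so that they
equal `1` on `B(ξⱼ, ε₀³)` also when `|ξⱼ| = 2`), frequency regions of width `60ε₀²` (modulus ratios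
up to `4`), threshold `ε₀ ≤ 1/1000` — for the rung-1 support item `CascadeNoDilOfSingleScaleAt`.
Theorems only; nothing here concerns the true Navier–Stokes equations.

* `abs_sub_norm_lt_of_scaleFactorAt_ne_zero`, `scaleFactorAt_ne_zero_unique` — at most one scale
  `n` has `φ(|(1+ε₀)^{-n}ζ - c|/ε₀²) ≠ 0` (`|c| ≥ 1/2`, `ε₀ ≤ 1/10`);
* `etaAt_nonneg`, `etaAt_le_one`, `measurable_etaAt_norm`;
* `singleScaleWeightAt_zero_regions` — where `φ(|ζ₁ - ξ 0|/ε₀²) η_ξ ≠ 0`: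
  `| |ζⱼ| - |ξ j| | < 60ε₀²` for the three frequencies (moduli of `ξ` in `[1/2, 2]`);
* `localShellAt_pos`, `localShellAt_lt`, `normShell_subset_fundamentalAt`,
  `isShellSupported_mul_shellCutoff_five`, `shellCutoff_five_eq_one_of_mem_closedBall` — the shells
  `{r² - 10ε₀³ < |ζ|² < r² + 10ε₀³}` of the width-`5ε₀³` radial cut-offs: positivity, admissibility
  for periodisation, containment of the `60ε₀²`-regions in the fundamental scale shell, and
  `χ_{r,5ε₀³} = 1` on `B(ξⱼ, ε₀³)`.

## References

* T. Tao, J. Amer. Math. Soc. 29 (2016), 601–674, arXiv:1402.0290v3, §3.3–§3.4 pp. 16–17,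
  Remark 3.5 p. 20. Key `Tao2016AveragedNS`.
-/

noncomputable section

open MeasureTheory Set Filter
open scoped ENNReal NNReal

namespace Literature.Analysis.FluidPDE.Tao2016

/-! ### At most one scale contributes to `ρ_ξ` at each frequency -/

/-- If the `n`-th scale factor `φ(|(1+ε₀)^{-n}ζ - c|/ε₀²)` is non-zero then
`| (1+ε₀)^{-n}|ζ| - |c| | < 2ε₀²`. [cite: Tao2016AveragedNS, §3.3 p. 16] -/
theorem abs_sub_norm_lt_of_scaleFactorAt_ne_zero {ε₀ : ℝ} (hε : 0 < ε₀) (c : EuclideanSpace ℝ (Fin 3)) {n : ℤ} {ζ : EuclideanSpace ℝ (Fin 3)}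
    (h : freqCutoff (‖((1 + ε₀) ^ (-n) : ℝ) • ζ - c‖ / ε₀ ^ 2) ≠ 0) :
    |((1 + ε₀) ^ (-n) : ℝ) * ‖ζ‖ - ‖c‖| < 2 * ε₀ ^ 2 := by
  have hq : 0 < 1 + ε₀ := by linarith
  have h2 := abs_lt_two_of_freqCutoff_ne_zero h
  have hε2 : 0 < ε₀ ^ 2 := pow_pos hε 2
  rw [abs_div, abs_of_pos hε2, div_lt_iff₀ hε2, abs_of_nonneg (norm_nonneg _)] at h2
  have hrev : |‖((1 + ε₀) ^ (-n) : ℝ) • ζ‖ - ‖c‖| ≤ ‖((1 + ε₀) ^ (-n) : ℝ) • ζ - c‖ :=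
    abs_norm_sub_norm_le _ _
  rw [norm_smul, Real.norm_of_nonneg (zpow_nonneg hq.le _)] at hrev
  linarith

/-- **At most one scale** about a centre with `|c| ≥ 1/2` (`0 < ε₀ ≤ 1/10`): if both the `n`-th and
the `n'`-th scale factors are non-zero at `ζ` then `n = n'` (consecutive scales differ by the factor
`1+ε₀ > (|c|+2ε₀²)/(|c|-2ε₀²)`). [cite: Tao2016AveragedNS, §3.3 p. 16] -/
theorem scaleFactorAt_ne_zero_unique {ε₀ : ℝ} (hε : 0 < ε₀) (hε1 : ε₀ ≤ 1 / 10) {c : EuclideanSpace ℝ (Fin 3)}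
    (hc : 1 / 2 ≤ ‖c‖) {n n' : ℤ} {ζ : EuclideanSpace ℝ (Fin 3)}
    (hn : freqCutoff (‖((1 + ε₀) ^ (-n) : ℝ) • ζ - c‖ / ε₀ ^ 2) ≠ 0)
    (hn' : freqCutoff (‖((1 + ε₀) ^ (-n') : ℝ) • ζ - c‖ / ε₀ ^ 2) ≠ 0) : n = n' := by
  have hq : 1 < 1 + ε₀ := by linarith
  have hq0 : 0 < 1 + ε₀ := by linarith
  have h1 := abs_sub_norm_lt_of_scaleFactorAt_ne_zero hε c hn
  have h2 := abs_sub_norm_lt_of_scaleFactorAt_ne_zero hε c hn'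
  rw [abs_lt] at h1 h2
  by_contra hne
  wlog hlt : n < n' generalizing n n'
  · exact this hn' hn h2 h1 (Ne.symm hne) (lt_of_le_of_ne (not_lt.1 hlt) (Ne.symm hne))
  set t : ℝ := (1 + ε₀) ^ (-n) * ‖ζ‖ with ht
  have hle : (1 : ℤ) ≤ n' - n := by omega
  have hrel : ((1 + ε₀) ^ (-n') : ℝ) * ‖ζ‖ = ((1 + ε₀) ^ (n' - n))⁻¹ * t := by
    rw [ht, ← mul_assoc, ← zpow_neg, ← zpow_add₀ hq0.ne']
    congr 2
    ring
  have hpow : (1 + ε₀) ≤ (1 + ε₀) ^ (n' - n) := by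
    calc (1 + ε₀) = (1 + ε₀) ^ (1 : ℤ) := (zpow_one _).symm
      _ ≤ (1 + ε₀) ^ (n' - n) := zpow_le_zpow_right₀ hq.le hle
  have ht0 : 0 ≤ t := mul_nonneg (zpow_nonneg hq0.le _) (norm_nonneg _)
  have hbig : 0 < (1 + ε₀) ^ (n' - n) := zpow_pos hq0 _
  have hup : ((1 + ε₀) ^ (n' - n))⁻¹ * t ≤ (1 + ε₀)⁻¹ * t :=
    mul_le_mul_of_nonneg_right ((inv_le_inv₀ hbig hq0).2 hpow) ht0
  rw [hrel] at h2
  have h3 : ‖c‖ - 2 * ε₀ ^ 2 < (1 + ε₀)⁻¹ * t := by linarith [h2.1]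
  rw [lt_inv_mul_iff₀ hq0] at h3
  nlinarith [h1.2]

/-! ### Bookkeeping for `η_ξ` -/

/-- `0 ≤ η_ξ`. [cite: Tao2016AveragedNS, §3.3 p. 16] -/
theorem etaAt_nonneg (ξ : Fin 3 → EuclideanSpace ℝ (Fin 3)) (ε₀ N₁ N₂ N₃ : ℝ) : 0 ≤ etaAt ξ ε₀ N₁ N₂ N₃ :=
  mul_nonneg (freqCutoff_nonneg _) (freqCutoff_nonneg _)

/-- `η_ξ ≤ 1`. [cite: Tao2016AveragedNS, §3.3 p. 16] -/
theorem etaAt_le_one (ξ : Fin 3 → EuclideanSpace ℝ (Fin 3)) (ε₀ N₁ N₂ N₃ : ℝ) : etaAt ξ ε₀ N₁ N₂ N₃ ≤ 1 :=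
  mul_le_one₀ (freqCutoff_le_one _) (freqCutoff_nonneg _) (freqCutoff_le_one _)

/-- The comparability weight `(ζ₁, ζ₂) ↦ η_ξ(|ζ₁|, |ζ₂|, |ζ₃|)` is measurable. [cite: Tao2016AveragedNS, §3.3 p. 16] -/
theorem measurable_etaAt_norm (ξ : Fin 3 → EuclideanSpace ℝ (Fin 3)) (ε₀ : ℝ) :
    Measurable fun p : EuclideanSpace ℝ (Fin 3) × EuclideanSpace ℝ (Fin 3) => etaAt ξ ε₀ ‖p.1‖ ‖p.2‖ ‖-p.1 - p.2‖ := by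
  have hφ : Measurable freqCutoff := (contDiff_freqCutoff (n := 0)).continuous.measurable
  have h1 : Measurable fun p : EuclideanSpace ℝ (Fin 3) × EuclideanSpace ℝ (Fin 3) => ‖p.1‖ := measurable_fst.norm
  have h2 : Measurable fun p : EuclideanSpace ℝ (Fin 3) × EuclideanSpace ℝ (Fin 3) => ‖p.2‖ := measurable_snd.norm
  have h3 : Measurable fun p : EuclideanSpace ℝ (Fin 3) × EuclideanSpace ℝ (Fin 3) => ‖-p.1 - p.2‖ := (measurable_fst.neg.sub measurable_snd).norm
  unfold etaAt
  exact (hφ.comp (((h2.div h1).sub measurable_const).div measurable_const)).mul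
    (hφ.comp (((h3.div h1).sub measurable_const).div measurable_const))

/-! ### Where the weight of `B_{η,ρ,0;ξ}` lives -/

/-- **Where the weight `φ(|ζ₁ - ξ 0|/ε₀²) η_ξ(|ζ₁|,|ζ₂|,|ζ₃|)` of `B_{η,ρ,0;ξ}` is non-zero**, for base
moduli `|ξ j| ∈ [1/2, 2]` and `0 < ε₀ ≤ 1/10`: `| |ζ₁| - |ξ 0| | < 2ε₀²` and
`| |ζ₂| - |ξ 1| | < 60ε₀²`, `| |ζ₃| - |ξ 2| | < 60ε₀²` (`η_ξ ≠ 0` forces the modulus ratios to within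
`20ε₀²` of those of `ξ`, which are at most `4`). [cite: Tao2016AveragedNS, §3.3–3.4 pp. 16–17] -/
theorem singleScaleWeightAt_zero_regions {ξ : Fin 3 → EuclideanSpace ℝ (Fin 3)} (hξ : ∀ j, 1 / 2 ≤ ‖ξ j‖ ∧ ‖ξ j‖ ≤ 2)
    {ε₀ : ℝ} (hε : 0 < ε₀) (hε1 : ε₀ ≤ 1 / 10) {p : EuclideanSpace ℝ (Fin 3) × EuclideanSpace ℝ (Fin 3)}
    (h : freqCutoff (‖p.1 - ξ 0‖ / ε₀ ^ 2) * etaAt ξ ε₀ ‖p.1‖ ‖p.2‖ ‖-p.1 - p.2‖ ≠ 0) :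
    p.1 ∈ normShell ‖ξ 0‖ (60 * ε₀ ^ 2) ∧ p.2 ∈ normShell ‖ξ 1‖ (60 * ε₀ ^ 2) ∧
      -p.1 - p.2 ∈ normShell ‖ξ 2‖ (60 * ε₀ ^ 2) := by
  have hε2 : 0 < ε₀ ^ 2 := pow_pos hε 2
  have hε100 : ε₀ ^ 2 ≤ 1 / 100 := by nlinarith
  have hφ := left_ne_zero_of_mul h
  have hη := right_ne_zero_of_mul h
  obtain ⟨h0l, h0u⟩ := hξ 0
  obtain ⟨h1l, h1u⟩ := hξ 1
  obtain ⟨h2l, h2u⟩ := hξ 2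
  have hN0 : 0 < ‖ξ 0‖ := by linarith
  -- slot 1
  have h1 : |‖p.1‖ - ‖ξ 0‖| < 2 * ε₀ ^ 2 := by
    have := abs_sub_norm_lt_of_scaleFactorAt_ne_zero hε (ξ 0) (n := 0) (ζ := p.1) (by simpa using hφ)
    simpa using this
  have h1' := h1
  rw [abs_lt] at h1'
  have hP1 : 0 < ‖p.1‖ := by nlinarith
  -- the two factors of `η_ξ`
  unfold etaAt at hη
  have ha := abs_lt_two_of_freqCutoff_ne_zero (left_ne_zero_of_mul hη)
  have hb := abs_lt_two_of_freqCutoff_ne_zero (right_ne_zero_of_mul hη)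
  have h10 : 0 < 10 * ε₀ ^ 2 := by positivity
  rw [abs_div, abs_of_pos h10, div_lt_iff₀ h10] at ha hb
  have ha : |‖p.2‖ / ‖p.1‖ - ‖ξ 1‖ / ‖ξ 0‖| < 20 * ε₀ ^ 2 := by linarith
  have hb : |‖-p.1 - p.2‖ / ‖p.1‖ - ‖ξ 2‖ / ‖ξ 0‖| < 20 * ε₀ ^ 2 := by linarith
  -- ratios
  set r₁ : ℝ := ‖ξ 1‖ / ‖ξ 0‖ with hr₁
  set r₂ : ℝ := ‖ξ 2‖ / ‖ξ 0‖ with hr₂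
  have hr₁4 : r₁ ≤ 4 := by rw [hr₁, div_le_iff₀ hN0]; linarith
  have hr₂4 : r₂ ≤ 4 := by rw [hr₂, div_le_iff₀ hN0]; linarith
  have hr₁0 : 0 ≤ r₁ := by positivity
  have hr₂0 : 0 ≤ r₂ := by positivity
  have hr₁e : r₁ * ‖ξ 0‖ = ‖ξ 1‖ := by rw [hr₁]; field_simp
  have hr₂e : r₂ * ‖ξ 0‖ = ‖ξ 2‖ := by rw [hr₂]; field_simp
  -- slot 2: `| |ζ₂| - r₁ |ζ₁| | < 20ε² |ζ₁|`
  have ha' : |‖p.2‖ - r₁ * ‖p.1‖| < 20 * ε₀ ^ 2 * ‖p.1‖ := by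
    have : ‖p.2‖ - r₁ * ‖p.1‖ = (‖p.2‖ / ‖p.1‖ - r₁) * ‖p.1‖ := by
      field_simp
    rw [this, abs_mul, abs_of_pos hP1]
    exact mul_lt_mul_of_pos_right ha hP1
  -- slot 3: `| |ζ₃| - r₂ |ζ₁| | < 20ε² |ζ₁|`
  have hb' : |‖-p.1 - p.2‖ - r₂ * ‖p.1‖| < 20 * ε₀ ^ 2 * ‖p.1‖ := by
    have : ‖-p.1 - p.2‖ - r₂ * ‖p.1‖ = (‖-p.1 - p.2‖ / ‖p.1‖ - r₂) * ‖p.1‖ := by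
      field_simp
    rw [this, abs_mul, abs_of_pos hP1]
    exact mul_lt_mul_of_pos_right hb hP1
  refine ⟨normShell_mono _ (by nlinarith) h1, ?_, ?_⟩
  · show |‖p.2‖ - ‖ξ 1‖| < 60 * ε₀ ^ 2
    rw [abs_lt] at ha' ⊢
    rw [← hr₁e]
    constructor <;> nlinarith
  · show |‖-p.1 - p.2‖ - ‖ξ 2‖| < 60 * ε₀ ^ 2
    rw [abs_lt] at hb' ⊢
    rw [← hr₂e]
    constructor <;> nlinarith

/-! ### The shells of the width-`5ε₀³` radial cut-offs -/

/-- The cut-off symbol `m χ_{r,5ε₀³}` is supported in the shell `{r² - 10ε₀³ < |ζ|² < r² + 10ε₀³}`.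
[cite: Tao2016AveragedNS, §3.4 p. 17] -/
theorem isShellSupported_mul_shellCutoff_five (m : EuclideanSpace ℝ (Fin 3) → ℂ) (r : ℝ) {ε₀ : ℝ} (hε : 0 < ε₀) :
    IsShellSupported (r ^ 2 - 10 * ε₀ ^ 3) (r ^ 2 + 10 * ε₀ ^ 3)
      (fun ζ => m ζ * shellCutoff r (5 * ε₀ ^ 3) ζ) := by
  intro ζ hζ
  have h := abs_lt_of_shellCutoff_ne_zero (by positivity) (right_ne_zero_of_mul hζ)
  rw [abs_lt] at h
  constructor <;> linarith [h.1, h.2]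

/-- The inner squared radius is positive (`1/2 ≤ r`, `0 < ε₀ ≤ 1/10`). [cite: Tao2016AveragedNS, §3.4 p. 17] -/
theorem localShellAt_pos {r ε₀ : ℝ} (hr : 1 / 2 ≤ r) (hε : 0 < ε₀) (hε1 : ε₀ ≤ 1 / 10) :
    0 < r ^ 2 - 10 * ε₀ ^ 3 := by
  nlinarith [pow_pos hε 3, mul_pos hε hε, pow_le_pow_left₀ hε.le hε1 3]

/-- **Admissibility of the shells for periodisation**: `r² + 10ε₀³ < (1+ε₀)² (r² - 10ε₀³)` for
`1/2 ≤ r` and `0 < ε₀ ≤ 1/10` (consecutive scales of the localised symbols have disjoint supports).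
[cite: Tao2016AveragedNS, §3.4 p. 17] -/
theorem localShellAt_lt {r ε₀ : ℝ} (hr : 1 / 2 ≤ r) (hε : 0 < ε₀) (hε1 : ε₀ ≤ 1 / 10) :
    r ^ 2 + 10 * ε₀ ^ 3 < (1 + ε₀) ^ 2 * (r ^ 2 - 10 * ε₀ ^ 3) := by
  have hr2 : 1 / 4 ≤ r ^ 2 := by nlinarith
  have hε2 : ε₀ ^ 2 ≤ ε₀ / 10 := by nlinarith
  have hε3 : ε₀ ^ 3 ≤ ε₀ / 100 := by nlinarith [pow_pos hε 2]
  nlinarith [pow_pos hε 3, mul_pos hε hε, mul_pos (mul_pos hε hε) (mul_pos hε hε),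
    mul_nonneg (sub_nonneg.2 hr2) hε.le]

/-- **The frequency regions of `B_{η,ρ,0;ξ}` lie in the fundamental scale shell of the localised
symbols**: for `1/2 ≤ r ≤ 2`, `0 < ε₀ ≤ 1/1000` and `| |ζ| - r | < 60ε₀²`,
`(r² + 10ε₀³)/(1+ε₀)² < |ζ|² < (1+ε₀)² (r² - 10ε₀³)` ("if `ε₀` is small enough").
[cite: Tao2016AveragedNS, §3.4 p. 17] -/
theorem normShell_subset_fundamentalAt {r ε₀ : ℝ} (hr : 1 / 2 ≤ r) (hr' : r ≤ 2) (hε : 0 < ε₀)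
    (hε1 : ε₀ ≤ 1 / 1000) {ζ : EuclideanSpace ℝ (Fin 3)} (hζ : ζ ∈ normShell r (60 * ε₀ ^ 2)) :
    (r ^ 2 + 10 * ε₀ ^ 3) / (1 + ε₀) ^ 2 < ‖ζ‖ ^ 2 ∧
      ‖ζ‖ ^ 2 < (1 + ε₀) ^ 2 * (r ^ 2 - 10 * ε₀ ^ 3) := by
  have hq : 0 < (1 + ε₀) ^ 2 := by positivity
  have hζ' : |‖ζ‖ - r| < 60 * ε₀ ^ 2 := hζ
  rw [abs_lt] at hζ'
  obtain ⟨hlo, hhi⟩ := hζ'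
  have ht0 : 0 ≤ ‖ζ‖ := norm_nonneg _
  have hε2 : 0 < ε₀ ^ 2 := pow_pos hε 2
  have hε3 : 0 < ε₀ ^ 3 := pow_pos hε 3
  have hεsmall : ε₀ ^ 2 ≤ ε₀ / 1000 := by nlinarith
  have hε3small : ε₀ ^ 3 ≤ ε₀ / 1000000 := by nlinarith
  have hr2 : 1 / 4 ≤ r ^ 2 := by nlinarith
  have hεr : ε₀ / 2 ≤ 2 * ε₀ * r ^ 2 := by nlinarith [mul_nonneg hε.le (sub_nonneg.2 hr2)]
  constructor
  · -- lower bound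
    rw [div_lt_iff₀ hq]
    have hpos : 0 ≤ r - 60 * ε₀ ^ 2 := by nlinarith
    have h1 : (r - 60 * ε₀ ^ 2) ^ 2 ≤ ‖ζ‖ ^ 2 := by nlinarith
    have h2 : r ^ 2 - 240 * ε₀ ^ 2 ≤ (r - 60 * ε₀ ^ 2) ^ 2 := by nlinarith
    have h3 : (1 + 2 * ε₀) * (r ^ 2 - 240 * ε₀ ^ 2) ≤ ‖ζ‖ ^ 2 * (1 + ε₀) ^ 2 := by
      have h4 : 0 ≤ r ^ 2 - 240 * ε₀ ^ 2 := by nlinarith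
      nlinarith
    have h5 : (1 + 2 * ε₀) * (r ^ 2 - 240 * ε₀ ^ 2) =
        r ^ 2 + 2 * ε₀ * r ^ 2 - 240 * ε₀ ^ 2 - 480 * (ε₀ * ε₀ ^ 2) := by ring
    have h6 : ε₀ * ε₀ ^ 2 ≤ ε₀ / 1000000 := by nlinarith
    have h7 : 10 * ε₀ ^ 3 + 240 * ε₀ ^ 2 + 480 * (ε₀ * ε₀ ^ 2) < 2 * ε₀ * r ^ 2 := by nlinarith
    linarith
  · -- upper bound
    have h1 : ‖ζ‖ ^ 2 < (r + 60 * ε₀ ^ 2) ^ 2 := by nlinarith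
    have h2 : (r + 60 * ε₀ ^ 2) ^ 2 ≤ r ^ 2 + 241 * ε₀ ^ 2 := by nlinarith
    have h3 : (1 + 2 * ε₀) * (r ^ 2 - 10 * ε₀ ^ 3) ≤ (1 + ε₀) ^ 2 * (r ^ 2 - 10 * ε₀ ^ 3) := by
      have h4 : 0 ≤ r ^ 2 - 10 * ε₀ ^ 3 := by nlinarith
      nlinarith
    have h5 : (1 + 2 * ε₀) * (r ^ 2 - 10 * ε₀ ^ 3) =
        r ^ 2 + 2 * ε₀ * r ^ 2 - 10 * ε₀ ^ 3 - 20 * (ε₀ * ε₀ ^ 3) := by ring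
    have h6 : ε₀ * ε₀ ^ 3 ≤ ε₀ / 1000000 := by nlinarith
    have h7 : 241 * ε₀ ^ 2 + 10 * ε₀ ^ 3 + 20 * (ε₀ * ε₀ ^ 3) < 2 * ε₀ * r ^ 2 := by nlinarith
    linarith

/-- **The cut-off `χ_{r,5ε₀³}` equals `1` on the ball `B(ζ₀, ε₀³)`, `|ζ₀| = r ≤ 2`** (`0 < ε₀ ≤ 1`):
`| |ζ|² - r² | = | |ζ| - r | (|ζ| + r) ≤ ε₀³ (4 + ε₀³) ≤ 5ε₀³` (the width `4ε₀³` of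
`TaoSingleScaleGeometry` needs `r ≤ 3/2`). [cite: Tao2016AveragedNS, §3.4 p. 17] -/
theorem shellCutoff_five_eq_one_of_mem_closedBall {r ε₀ : ℝ} (hr : 0 ≤ r) (hr' : r ≤ 2)
    (hε : 0 < ε₀) (hε1 : ε₀ ≤ 1) {ζ₀ ζ : EuclideanSpace ℝ (Fin 3)} (hζ₀ : ‖ζ₀‖ = r)
    (hζ : ζ ∈ Metric.closedBall ζ₀ (ε₀ ^ 3)) : shellCutoff r (5 * ε₀ ^ 3) ζ = 1 := by
  refine shellCutoff_eq_one (by positivity) ?_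
  rw [Metric.mem_closedBall, dist_eq_norm] at hζ
  have hε3 : ε₀ ^ 3 ≤ 1 := pow_le_one₀ hε.le hε1
  have hd : |‖ζ‖ - r| ≤ ε₀ ^ 3 := by
    rw [← hζ₀]
    exact (abs_norm_sub_norm_le ζ ζ₀).trans hζ
  have hsum : ‖ζ‖ + r ≤ 4 + ε₀ ^ 3 := by
    rw [abs_le] at hd
    linarith
  have hsum0 : 0 ≤ ‖ζ‖ + r := by positivity
  calc |‖ζ‖ ^ 2 - r ^ 2| = |‖ζ‖ - r| * (‖ζ‖ + r) := by
        rw [show ‖ζ‖ ^ 2 - r ^ 2 = (‖ζ‖ - r) * (‖ζ‖ + r) by ring, abs_mul, abs_of_nonneg hsum0]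
    _ ≤ ε₀ ^ 3 * (4 + ε₀ ^ 3) := mul_le_mul hd hsum hsum0 (by positivity)
    _ ≤ 5 * ε₀ ^ 3 := by
        nlinarith [mul_le_mul_of_nonneg_left hε3 (pow_pos hε 3).le]

end Literature.Analysis.FluidPDE.Tao2016
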